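import Summits.QuantumAdvantage.QuantumAdvantage.Theorems.HintDialTable
import Summits.QuantumAdvantage.QuantumAdvantage.Theorems.GapDialDilution
import Summits.QuantumAdvantage.QuantumAdvantage.Theorems.FlatDialStrings

/-!
# CouplingDial (part A, core) — coupled triples, the co-rank slices `U_d`, the transfer lemma, the EQUIV `T ⟺ T′`

Tree twin of the cell node `decomp-qadv` lens-3 g12 «CouplingDial» rev 2 (§1–§6, cut verbatim; record `run/shared/lean/pub/decomp-qadv/
decomp-qadv-lens-3/g12/NODE-g12.md`).  A COUPLED TRIPLE `(F, L, G)` presents the phase `F(x) ⊕ ⟨x, Ly⟩ ⊕ G(y)` — signed cubic Forrelation whose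
Hadamard layer is twisted by an explicit Boolean matrix `L`; `CTriple.cvalue` is its value, `CTriple.kerCard = |ker L|` the co-rank measure,
`CoupledSlice d` / `CouplingRung d` (`U_d`) the exact slices of co-rank `≤ d(n)` and their promise-`AC⁰[⊕]` rungs, `IdCoupledSlice` /
`IdCouplingRung` (`T′`) the identity-coupled slice.  Proved here: monotonicity in `d`; the generic TRANSFER LEMMA `promiseLift_AC0Mod_of_red`
(promise-`AC⁰[p]` is closed under `AC⁰[p]`-realisable many-one reductions `IsACRed`; literal projections `isACRed_of_isProj`); the two
recodings `recA` / `recB`; `T ⟹ U_d` for every `d`; the EQUIV `rungANonuniform_iff_idCouplingRung : AnfPresentation.RungANonuniform ↔ IdCouplingRung`.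
-/

set_option linter.dupNamespace false

noncomputable section

namespace Summit.QuantumAdvantage.QuantumAdvantage.Theorems.CouplingDial

open Finset
open Literature.Computability.Complexity
open Literature.Computability.QuantumComplexity
open Literature.Computability.MetaComplexity
open _root_.Computability (encodeNat)
open Summit.QuantumAdvantage.QuantumAdvantage.Theorems.HintDial
open Summit.QuantumAdvantage.QuantumAdvantage.Theorems.HintDial.Automaton
open Summit.QuantumAdvantage.QuantumAdvantage.Theorems.GapDial.Automaton (blockDiag blockDiag_left blockDiag_right
  mv_blockDiag bd_zero_left EE bxor_append)
open Summit.QuantumAdvantage.QuantumAdvantage.Theorems.FlatDial (clen length_encode_eq_clen clen_injective clen_lt_clen le_clen)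
open Summit.QuantumAdvantage.QuantumAdvantage.Theses.AnfPresentation (RungANonuniform RungA LiftA AnfEquiv NearExactIsExact
  SignedExactSliceIsLift)
open CubicForm (bit)
open DerivativeWalsh (W)
open BuzetChailloux (bxor zeroVec)

/-! ## §1 Coupled instances: two cubic layers and a linear coupling `L` between them -/

/-- ★ A COUPLED TRIPLE: arity `n`, two cubic coefficient tables `F`, `G` and an `n × n` Boolean COUPLING MATRIX `L`; it presents the
phase polynomial `P(x,y) = F(x) ⊕ ⟨x, L y⟩ ⊕ G(y)` (the Hadamard layer between the two phase layers replaced by the partial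
Hadamard / CNOT network of `L`). -/
structure CTriple where
  /-- arity -/
  n : ℕ
  /-- first cubic layer -/
  F : CubicForm n
  /-- second cubic layer -/
  G : CubicForm n
  /-- the coupling matrix (`L a b` = entry in row `a`, column `b`) -/
  L : Fin n → Fin n → Bool

namespace CTriple

/-- ★ THE COUPLED FORRELATION VALUE `Φ_L(F,G) = 2^{-3n/2} Σ_{x,y} (-1)^{F(x)} (-1)^{⟨x, Ly⟩} (-1)^{G(y)}` (`mv L y = L y` over `𝔽₂`). -/
def cvalue (I : CTriple) : ℝ :=
  (Real.sqrt (2 ^ (3 * I.n)))⁻¹ *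
    ∑ x : Fin I.n → Bool, ∑ y : Fin I.n → Bool, signOf (I.F.eval x) * twist x (mv I.L y) * signOf (I.G.eval y)

/-- ★ THE CO-RANK, combinatorially: the number `|ker L| = 2^{n - rank L}` of solutions of `L y = 0`. -/
def kerCard (I : CTriple) : ℕ := Fintype.card {y : Fin I.n → Bool // mv I.L y = zeroVec}

/-- the `n²` matrix bits, row-major. -/
def matBits {n : ℕ} (L : Fin n → Fin n → Bool) : List Bool :=
  List.ofFn fun q : Fin (n * n) => L (finProdFinEquiv.symm q).1 (finProdFinEquiv.symm q).2

/-- the underlying (uncoupled) ANF pair `(n, F, G)`. -/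
def pair (I : CTriple) : CubicANFPair := ⟨I.n, I.F, I.G⟩

/-- ★ THE CODE of a coupled triple: `⟨matrix bits, code (n, F, G)⟩` (`boolPair` pairing of the tree; the pair code of
`SignedExactCubicSliceANF` is the literal SUFFIX, the matrix a literal prefix). -/
def encode (I : CTriple) : List Bool := boolPair (matBits I.L) I.pair.encode

end CTriple

/-- length of a coupled code of arity `n` (`clen n` = length of the pair code, `FlatDial.length_encode_eq_clen`). -/
def tlen (n : ℕ) : ℕ := 2 * (n * n) + 2 + clen n
/-- CouplingDialCore helper `length_matBits` (decomp-qadv land package; see the module docstring). -/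
theorem length_matBits {n : ℕ} (L : Fin n → Fin n → Bool) : (CTriple.matBits L).length = n * n := by
  simp [CTriple.matBits]
/-- CouplingDialCore helper `length_encode` (decomp-qadv land package; see the module docstring). -/
theorem length_encode (I : CTriple) : I.encode.length = tlen I.n := by
  rw [CTriple.encode, length_boolPair, length_matBits, length_encode_eq_clen, tlen]; rfl
/-- CouplingDialCore helper `tlen_lt_tlen` (decomp-qadv land package; see the module docstring). -/
theorem tlen_lt_tlen {n n' : ℕ} (h : n < n') : tlen n < tlen n' := by
  have h1 : n * n ≤ n' * n' := Nat.mul_le_mul h.le h.le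
  have h2 := clen_lt_clen h
  unfold tlen; omega
/-- CouplingDialCore helper `tlen_injective` (decomp-qadv land package; see the module docstring). -/
theorem tlen_injective : Function.Injective tlen := by
  intro a b h
  rcases lt_trichotomy a b with hab | hab | hab
  · exact absurd h (tlen_lt_tlen hab).ne
  · exact hab
  · exact absurd h (tlen_lt_tlen hab).ne'

/-! ## §2 The dial: coupled slices of co-rank `≤ d(n)` and their `AC⁰[⊕]` rungs -/

/-- ★ THE CO-RANK-`d` COUPLED SLICE `𝒞_d`: codes of coupled triples with `n` even, `|ker L| ≤ 2^{d(n)}` (co-rank `≤ d(n)`) and coupled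
value EXACTLY `+1` (yes) / `-1` (no). `d = 0`: invertible (hidden) couplings; `d = n`: no constraint (contains the SOLO problem). -/
def CoupledSlice (d : ℕ → ℕ) : PromiseProblem :=
  ⟨CTriple.encode '' {I | Even I.n ∧ I.kerCard ≤ 2 ^ d I.n ∧ I.cvalue = 1},
    CTriple.encode '' {I | Even I.n ∧ I.kerCard ≤ 2 ^ d I.n ∧ I.cvalue = -1}⟩

/-- ★ THE RUNG `U_d`: the co-rank-`d` coupled slice is not in promise-`AC⁰[⊕]`. -/
def CouplingRung (d : ℕ → ℕ) : Prop := CoupledSlice d ∉ promiseLift (AC0Mod 2)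

/-- ★ `W` = `U_0`, HIDDEN INVERTIBLE COUPLING: signed exact cubic Forrelation whose Hadamard layer is twisted by an arbitrary invertible
linear map `L` given in the instance (`|ker L| ≤ 1`) is not in promise-`AC⁰[⊕]`. -/
def HiddenCouplingRung : Prop := CouplingRung fun _ => 0

/-- ★ `R` = THE RESIDUAL (one-notch lift): hidden-invertible-coupling hardness lifts to the identity coupling (item 27991). -/
def CouplingLift : Prop := HiddenCouplingRung → RungANonuniform

/-- ★ THE IDENTITY-COUPLED SLICE (the EQUIV's right-hand side): coupled triples whose matrix IS the identity. -/
def IdCoupledSlice : PromiseProblem :=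
  ⟨CTriple.encode '' {I | Even I.n ∧ I.L = dM ∧ I.cvalue = 1}, CTriple.encode '' {I | Even I.n ∧ I.L = dM ∧ I.cvalue = -1}⟩

/-- ★ `T′`: the identity-coupled slice is not in promise-`AC⁰[⊕]`. -/
def IdCouplingRung : Prop := IdCoupledSlice ∉ promiseLift (AC0Mod 2)

/-! ## §3 Monotonicity of the dial in the co-rank budget (sub-promise inclusion) -/

/-- CouplingDialCore helper `coupledSlice_yes_mono` (decomp-qadv land package; see the module docstring). -/
theorem coupledSlice_yes_mono {d₁ d₂ : ℕ → ℕ} (h : ∀ n, d₁ n ≤ d₂ n) :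
    ∀ x, x ∈ (CoupledSlice d₁).yes → x ∈ (CoupledSlice d₂).yes := by
  rintro x ⟨I, ⟨he, hk, hv⟩, rfl⟩
  exact ⟨I, ⟨he, hk.trans (Nat.pow_le_pow_right Nat.two_pos (h I.n)), hv⟩, rfl⟩

/-- CouplingDialCore helper `coupledSlice_no_mono` (decomp-qadv land package; see the module docstring). -/
theorem coupledSlice_no_mono {d₁ d₂ : ℕ → ℕ} (h : ∀ n, d₁ n ≤ d₂ n) :
    ∀ x, x ∈ (CoupledSlice d₁).no → x ∈ (CoupledSlice d₂).no := by
  rintro x ⟨I, ⟨he, hk, hv⟩, rfl⟩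
  exact ⟨I, ⟨he, hk.trans (Nat.pow_le_pow_right Nat.two_pos (h I.n)), hv⟩, rfl⟩

/-- ★ THE DIAL IS MONOTONE: a larger co-rank budget is a WEAKER rung (`d₁ ≤ d₂ ⟹ U_{d₁} → U_{d₂}`). -/
theorem couplingRung_mono {d₁ d₂ : ℕ → ℕ} (h : ∀ n, d₁ n ≤ d₂ n) : CouplingRung d₁ → CouplingRung d₂ :=
  fun h₁ ⟨L, hL, hy, hn⟩ => h₁ ⟨L, hL, fun x hx => hy (coupledSlice_yes_mono h x hx), fun x hx => hn (coupledSlice_no_mono h x hx)⟩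

/-- `U_0` is the top of the dial. -/
theorem couplingRung_of_hidden (d : ℕ → ℕ) : HiddenCouplingRung → CouplingRung d :=
  couplingRung_mono fun _ => Nat.zero_le _

/-! ## §4 The generic transfer lemma: promise-`AC⁰[p]` is closed under realisable many-one reductions -/

/-- A string map `Ψ_N : {0,1}^N → {0,1}^*` is an `AC⁰[p]`-REDUCTION FAMILY of depth `d₀` within size `S`: at every input length its
output has a fixed length `≤ S(N)` and every output bit is realised over `accBasis p` in depth `d₀`, size `≤ S(N)`.  Literal projections
are the case `d₀ = 1`. -/
def IsACRed (p d₀ : ℕ) (S : Polynomial ℕ) (Ψ : (N : ℕ) → (Fin N → Bool) → List Bool) : Prop :=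
  ∀ N, ∃ ℓ : ℕ, ℓ ≤ S.eval N ∧ ∃ g : Fin ℓ → (Fin N → Bool) → Bool,
    (∀ u, Ψ N u = List.ofFn fun j => g j u) ∧ ∀ j, ACRealOver (accBasis p) (g j) d₀ (S.eval N)

/-- ★ Literal projections of polynomially bounded length are `AC⁰[p]`-reduction families (depth `1`). -/
theorem isACRed_of_isProj {p : ℕ} {Ψ : (N : ℕ) → (Fin N → Bool) → List Bool} (hΨ : ∀ N, IsProj (Ψ N)) (S : Polynomial ℕ)
    (hS : ∀ N u, (Ψ N u).length ≤ S.eval N) (hS1 : ∀ N, 1 ≤ S.eval N) : IsACRed p 1 S Ψ := by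
  intro N
  obtain ⟨s, hs⟩ := hΨ N
  have hl : s.length ≤ S.eval N := by
    have := hS N fun _ => false
    rwa [hs, List.length_map] at this
  refine ⟨s.length, hl, fun j u => evalLit u (s.get j), fun u => ?_, fun j => (acRealOver_evalLit p (s.get j)).mono le_rfl (hS1 N)⟩
  rw [hs, ofFn_evalLit]

/-- ★★ THE TRANSFER LEMMA: if `Ψ` is an `AC⁰[p]`-reduction family mapping yes-instances of `Q₁` to yes-instances of `Q₂` and
no-instances to no-instances, then `Q₂ ∈ promiseLift AC⁰[p] ⟹ Q₁ ∈ promiseLift AC⁰[p]` (compose the separating family with `Ψ`: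
`acRealOver_circuit_comp`, depth `+ d₀`, polynomial size). -/
theorem promiseLift_AC0Mod_of_red {p d₀ : ℕ} {S : Polynomial ℕ} {Q₁ Q₂ : PromiseProblem} (Ψ : (N : ℕ) → (Fin N → Bool) → List Bool)
    (hΨ : IsACRed p d₀ S Ψ) (hy : ∀ x ∈ Q₁.yes, Ψ x.length x.get ∈ Q₂.yes) (hn : ∀ x ∈ Q₁.no, Ψ x.length x.get ∈ Q₂.no)
    (h₂ : Q₂ ∈ promiseLift (AC0Mod p)) : Q₁ ∈ promiseLift (AC0Mod p) := by
  obtain ⟨L, ⟨d, r, C, hC, hDec⟩, hyes, hno⟩ := h₂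
  choose ℓ hℓ g hg hR using hΨ
  -- the composed family
  have hD : ∀ N : ℕ, ∃ D : Circuit (Fin N), D.IsOver (accBasis p) ∧ D.acDepth ≤ d + d₀ ∧
      D.size ≤ r.eval (ℓ N) + (ℓ N) * S.eval N ∧ D.Computes fun u => (C (ℓ N)).eval fun j => g N j u := by
    intro N
    have h := acRealOver_circuit_comp (C (ℓ N)) (hC _).1 (fun j => hR N j)
    refine (h.mono ?_ ?_).toCircuit
    · exact Nat.add_le_add_right (hC _).2.1 d₀
    · refine Nat.add_le_add (hC _).2.2 (le_of_eq ?_)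
      simp
  choose D hD using hD
  refine ⟨{x | (D x.length).eval x.get = true}, ⟨d + d₀, r.comp S + S * S, D,
    fun N => ⟨(hD N).1, (hD N).2.1, (hD N).2.2.1.trans ?_⟩, fun x => ?_⟩, ?_, ?_⟩
  · show _ ≤ Polynomial.eval N (r.comp S + S * S)
    rw [Polynomial.eval_add, Polynomial.eval_comp, Polynomial.eval_mul]
    exact Nat.add_le_add (natPoly_eval_mono r (hℓ N)) (Nat.mul_le_mul_right _ (hℓ N))
  · cases h : (D x.length).eval x.get
    · symm; exact (Set.notMem_iff_boolIndicator _ _).1 (by simp [h])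
    · symm; exact (Set.mem_iff_boolIndicator _ _).1 (by simpa using h)
  · intro x hx
    show (D x.length).eval x.get = true
    rw [(hD x.length).2.2.2 x.get]
    beta_reduce
    rw [hDec.eval_eq, ← hg]
    exact (Set.mem_iff_boolIndicator _ _).1 (hyes (hy x hx))
  · intro x hx
    show ¬ (D x.length).eval x.get = true
    rw [(hD x.length).2.2.2 x.get]
    beta_reduce
    rw [hDec.eval_eq, ← hg, (Set.notMem_iff_boolIndicator _ _).1 (hno (hn x hx))]
    exact Bool.false_ne_true

/-- ★ Contrapositive form used by the dial: hardness transfers DOWN a reduction. -/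
theorem not_promiseLift_of_red {p d₀ : ℕ} {S : Polynomial ℕ} {Q₁ Q₂ : PromiseProblem} (Ψ : (N : ℕ) → (Fin N → Bool) → List Bool)
    (hΨ : IsACRed p d₀ S Ψ) (hy : ∀ x ∈ Q₁.yes, Ψ x.length x.get ∈ Q₂.yes) (hn : ∀ x ∈ Q₁.no, Ψ x.length x.get ∈ Q₂.no)
    (h₁ : Q₁ ∉ promiseLift (AC0Mod p)) : Q₂ ∉ promiseLift (AC0Mod p) :=
  fun h₂ => h₁ (promiseLift_AC0Mod_of_red Ψ hΨ hy hn h₂)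

/-! ## §5 String plumbing: the two recodings between pair codes and identity-coupled triple codes are literal projections -/

/-- CouplingDialCore helper `boolPair_eq_append` (decomp-qadv land package; see the module docstring). -/
private theorem boolPair_eq_append (a b : List Bool) : boolPair a b = boolPair a [] ++ b := by
  simp [boolPair]

/-- dropping the doubled prefix and the separator of a `boolPair` leaves the second component. -/
theorem drop_boolPair (a b : List Bool) : (boolPair a b).drop (2 * a.length + 2) = b := by
  rw [boolPair_eq_append a b, show 2 * a.length + 2 = (boolPair a []).length by rw [length_boolPair, List.length_nil, add_zero]]
  exact List.drop_left

/-- the identity string map is a literal projection. -/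
theorem isProj_ofFn {N : ℕ} : IsProj fun u : Fin N → Bool => List.ofFn u :=
  ⟨List.ofFn fun i => Sum.inr (false, i), fun u => by
    show List.ofFn u = _
    rw [List.map_ofFn]; exact congrArg _ (funext fun i => (Bool.false_xor (u i)).symm)⟩

/-- dropping a fixed-length prefix is a literal projection. -/
theorem isProj_ofFn_drop {N : ℕ} (k : ℕ) : IsProj fun u : Fin N → Bool => (List.ofFn u).drop k :=
  ⟨((List.finRange N).drop k).map fun i => Sum.inr (false, i), fun u => by
    show (List.ofFn u).drop k = _
    rw [List.ofFn_eq_map, ← List.map_drop, List.map_map]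
    exact congrArg₂ _ (funext fun i => (Bool.false_xor (u i)).symm) rfl⟩

open Classical in
/-- the arity read off a PAIR-code length (`0` off the code lengths). -/
def arityP (N : ℕ) : ℕ := if h : ∃ n, clen n = N then h.choose else 0

/-- CouplingDialCore helper `arityP_clen` (decomp-qadv land package; see the module docstring). -/
theorem arityP_clen (n : ℕ) : arityP (clen n) = n := by
  have h : ∃ n', clen n' = clen n := ⟨n, rfl⟩
  rw [arityP, dif_pos h]; exact clen_injective h.choose_spec

/-- CouplingDialCore helper `arityP_le` (decomp-qadv land package; see the module docstring). -/
theorem arityP_le (N : ℕ) : arityP N ≤ N := by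
  unfold arityP; split
  · next h => calc h.choose ≤ clen h.choose := le_clen _
      _ = N := h.choose_spec
  · exact Nat.zero_le _

open Classical in
/-- the arity read off a TRIPLE-code length. -/
def arityT (N : ℕ) : ℕ := if h : ∃ n, tlen n = N then h.choose else 0

/-- CouplingDialCore helper `arityT_tlen` (decomp-qadv land package; see the module docstring). -/
theorem arityT_tlen (n : ℕ) : arityT (tlen n) = n := by
  have h : ∃ n', tlen n' = tlen n := ⟨n, rfl⟩
  rw [arityT, dif_pos h]; exact tlen_injective h.choose_spec

/-- padding a pair code with the identity matrix of arity `k`. -/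
def padId (k : ℕ) (x : List Bool) : List Bool := boolPair (CTriple.matBits (dM : Fin k → Fin k → Bool)) x

/-- ★ RECODING A (pair code ↦ identity-coupled triple code), as a string map on each input length. -/
def recA (N : ℕ) (u : Fin N → Bool) : List Bool := padId (arityP N) (List.ofFn u)

/-- ★ RECODING B (triple code ↦ its pair-code suffix). -/
def recB (N : ℕ) (u : Fin N → Bool) : List Bool := (List.ofFn u).drop (2 * (arityT N * arityT N) + 2)

/-- CouplingDialCore helper `isProj_recA` (decomp-qadv land package; see the module docstring). -/
theorem isProj_recA (N : ℕ) : IsProj (recA N) := (IsProj.const _).boolPair isProj_ofFn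

/-- CouplingDialCore helper `isProj_recB` (decomp-qadv land package; see the module docstring). -/
theorem isProj_recB (N : ℕ) : IsProj (recB N) := isProj_ofFn_drop _

/-- CouplingDialCore helper `length_recA` (decomp-qadv land package; see the module docstring). -/
theorem length_recA (N : ℕ) (u : Fin N → Bool) : (recA N u).length ≤ (2 * Polynomial.X ^ 2 + Polynomial.X + 2 : Polynomial ℕ).eval N := by
  have h := arityP_le N
  have h2 : arityP N * arityP N ≤ N * N := Nat.mul_le_mul h h
  simp only [recA, padId, length_boolPair, length_matBits, List.length_ofFn, Polynomial.eval_add, Polynomial.eval_mul,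
    Polynomial.eval_pow, Polynomial.eval_X, Polynomial.eval_ofNat]
  nlinarith

/-- CouplingDialCore helper `length_recB` (decomp-qadv land package; see the module docstring). -/
theorem length_recB (N : ℕ) (u : Fin N → Bool) : (recB N u).length ≤ (Polynomial.X + 1 : Polynomial ℕ).eval N := by
  simp only [recB, List.length_drop, List.length_ofFn, Polynomial.eval_add, Polynomial.eval_X, Polynomial.eval_one]
  omega

/-- CouplingDialCore helper `isACRed_recA` (decomp-qadv land package; see the module docstring). -/
theorem isACRed_recA (p : ℕ) : IsACRed p 1 (2 * Polynomial.X ^ 2 + Polynomial.X + 2) recA :=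
  isACRed_of_isProj isProj_recA _ length_recA fun N => by simp

/-- CouplingDialCore helper `isACRed_recB` (decomp-qadv land package; see the module docstring). -/
theorem isACRed_recB (p : ℕ) : IsACRed p 1 (Polynomial.X + 1) recB :=
  isACRed_of_isProj isProj_recB _ length_recB fun N => by simp

/-- the identity-coupled triple over a pair. -/
def idTriple (J : CubicANFPair) : CTriple := ⟨J.n, J.F, J.G, dM⟩

/-- ★ Recoding A sends the code of `(n,F,G)` to the code of `(n,F,G,𝟙)`. -/
theorem recA_encode (J : CubicANFPair) : recA J.encode.length J.encode.get = (idTriple J).encode := by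
  rw [recA, List.ofFn_get, length_encode_eq_clen, arityP_clen]; rfl

/-- ★ Recoding B sends the code of `(n,F,G,L)` to the code of `(n,F,G)`. -/
theorem recB_encode (I : CTriple) : recB I.encode.length I.encode.get = I.pair.encode := by
  rw [recB, List.ofFn_get, length_encode, arityT_tlen, CTriple.encode, ← length_matBits I.L, drop_boolPair]

/-! ## §6 Semantics of the identity coupling; `T ⟹ U_d` for every budget; the EQUIV `T ⟺ T′` -/

/-- with the identity matrix the coupled value IS the Forrelation value of the pair. -/
theorem cvalue_idTriple (J : CubicANFPair) : (idTriple J).cvalue = J.value := by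
  unfold CTriple.cvalue idTriple CubicANFPair.value forrelation
  simp_rw [mv_dM]

/-- CouplingDialCore helper `cvalue_of_L_eq_dM` (decomp-qadv land package; see the module docstring). -/
theorem cvalue_of_L_eq_dM (I : CTriple) (h : I.L = dM) : I.cvalue = I.pair.value := by
  obtain ⟨n, F, G, L⟩ := I
  dsimp only at h
  subst h
  exact cvalue_idTriple ⟨n, F, G⟩

/-- the identity coupling has trivial kernel. -/
theorem kerCard_idTriple (J : CubicANFPair) : (idTriple J).kerCard ≤ 1 := by
  refine Fintype.card_le_one_iff_subsingleton.2 ⟨fun a b => Subtype.ext ?_⟩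
  have ha := a.2; have hb := b.2
  simp only [idTriple, mv_dM] at ha hb
  rw [ha, hb]

/-- CouplingDialCore helper `recA_yes` (decomp-qadv land package; see the module docstring). -/
theorem recA_yes (d : ℕ → ℕ) : ∀ x ∈ SignedExactCubicSliceANF.yes, recA x.length x.get ∈ (CoupledSlice d).yes := by
  rintro x ⟨J, ⟨he, hv⟩, rfl⟩
  rw [recA_encode]
  exact ⟨idTriple J, ⟨he, (kerCard_idTriple J).trans Nat.one_le_two_pow, (cvalue_idTriple J).trans hv⟩, rfl⟩

/-- CouplingDialCore helper `recA_no` (decomp-qadv land package; see the module docstring). -/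
theorem recA_no (d : ℕ → ℕ) : ∀ x ∈ SignedExactCubicSliceANF.no, recA x.length x.get ∈ (CoupledSlice d).no := by
  rintro x ⟨J, ⟨he, hv⟩, rfl⟩
  rw [recA_encode]
  exact ⟨idTriple J, ⟨he, (kerCard_idTriple J).trans Nat.one_le_two_pow, (cvalue_idTriple J).trans hv⟩, rfl⟩

/-- ★★ EDGE `T ⟹ U_d` (every `d`): the solo slice projection-reduces into every coupled slice (pad with `L = 𝟙`, `|ker 𝟙| = 1 ≤ 2^{d(n)}`),
so each rung of the dial is NECESSARY for item 27991 — in particular `T ⟹ W`. -/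
theorem couplingRung_of_rungANonuniform (d : ℕ → ℕ) : RungANonuniform → CouplingRung d :=
  not_promiseLift_of_red recA (isACRed_recA 2) (recA_yes d) (recA_no d)

/-- CouplingDialCore helper `hidden_of_rungANonuniform` (decomp-qadv land package; see the module docstring). -/
theorem hidden_of_rungANonuniform : RungANonuniform → HiddenCouplingRung := couplingRung_of_rungANonuniform _

/-- CouplingDialCore helper `recA_yes_id` (decomp-qadv land package; see the module docstring). -/
theorem recA_yes_id : ∀ x ∈ SignedExactCubicSliceANF.yes, recA x.length x.get ∈ IdCoupledSlice.yes := by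
  rintro x ⟨J, ⟨he, hv⟩, rfl⟩
  rw [recA_encode]
  exact ⟨idTriple J, ⟨he, rfl, (cvalue_idTriple J).trans hv⟩, rfl⟩

/-- CouplingDialCore helper `recA_no_id` (decomp-qadv land package; see the module docstring). -/
theorem recA_no_id : ∀ x ∈ SignedExactCubicSliceANF.no, recA x.length x.get ∈ IdCoupledSlice.no := by
  rintro x ⟨J, ⟨he, hv⟩, rfl⟩
  rw [recA_encode]
  exact ⟨idTriple J, ⟨he, rfl, (cvalue_idTriple J).trans hv⟩, rfl⟩

/-- CouplingDialCore helper `recB_yes_id` (decomp-qadv land package; see the module docstring). -/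
theorem recB_yes_id : ∀ x ∈ IdCoupledSlice.yes, recB x.length x.get ∈ SignedExactCubicSliceANF.yes := by
  rintro x ⟨I, ⟨he, hL, hv⟩, rfl⟩
  rw [recB_encode]
  exact ⟨I.pair, ⟨he, (cvalue_of_L_eq_dM I hL).symm.trans hv⟩, rfl⟩

/-- CouplingDialCore helper `recB_no_id` (decomp-qadv land package; see the module docstring). -/
theorem recB_no_id : ∀ x ∈ IdCoupledSlice.no, recB x.length x.get ∈ SignedExactCubicSliceANF.no := by
  rintro x ⟨I, ⟨he, hL, hv⟩, rfl⟩
  rw [recB_encode]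
  exact ⟨I.pair, ⟨he, (cvalue_of_L_eq_dM I hL).symm.trans hv⟩, rfl⟩

/-- ★★ THE ONE EQUIV (certified translation, both directions literal projections): item 27991 `⟺` hardness of the identity-coupled
slice in the coupled presentation. [COSTUME by design: a recoding.] -/
theorem rungANonuniform_iff_idCouplingRung : RungANonuniform ↔ IdCouplingRung :=
  ⟨not_promiseLift_of_red recA (isACRed_recA 2) recA_yes_id recA_no_id,
    not_promiseLift_of_red recB (isACRed_recB 2) recB_yes_id recB_no_id⟩

/-- ★ THE SPLIT BENEATH THE EQUIV, edge 1: `T′ ⟹ W` (the identity-coupled slice is a sub-promise of the co-rank-`0` slice). -/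
theorem hidden_of_idCouplingRung : IdCouplingRung → HiddenCouplingRung := by
  rintro h ⟨L, hL, hy, hn⟩
  refine h ⟨L, hL, fun x hx => hy ?_, fun x hx => hn ?_⟩
  · obtain ⟨I, ⟨he, hI, hv⟩, rfl⟩ := hx
    refine ⟨I, ⟨he, ?_, hv⟩, rfl⟩
    obtain ⟨n, F, G, L⟩ := I
    dsimp only at hI
    subst hI
    exact (kerCard_idTriple ⟨n, F, G⟩).trans (le_of_eq (pow_zero 2).symm)
  · obtain ⟨I, ⟨he, hI, hv⟩, rfl⟩ := hx
    refine ⟨I, ⟨he, ?_, hv⟩, rfl⟩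
    obtain ⟨n, F, G, L⟩ := I
    dsimp only at hI
    subst hI
    exact (kerCard_idTriple ⟨n, F, G⟩).trans (le_of_eq (pow_zero 2).symm)

end Summit.QuantumAdvantage.QuantumAdvantage.Theorems.CouplingDial

end
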